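import Mathlib
import Summits.Ventures.HodgeRepro.Statements
import Summits.Ventures.HodgeRepro.MuTableSeesaw
import Summits.Ventures.HodgeRepro.MuTableSwap
import Summits.Ventures.HodgeRepro.MuTableWitness
import Summits.Ventures.HodgeRepro.MuTableSigns

/-!
# Every slot table of the sealed statement (b) occurs (seat p2, gen 7)

Combining the free-signs theorem `MuTableSigns.exists_conj_fixed_with_signs` (weak approximation in `L⁺`) with the
diagonal and crossed constructions of `MuTableWitness.lean`: for every choice `f` of the places where the two lines
`W₀, W₁` are to have opposite signs and every choice `g` of which line is the positive one there, there is a seesaw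
datum `S` whose slot table is `δ_S(w) = (if g w then 1 else -1) · (if 0 < im w(δ) then 3 else -3)` at the places
in `f` and `0` elsewhere — with the relabelling bit OFF everywhere (diagonal datum, `g = 1`) or ON exactly on `f`
(crossed datum, `g` = the coordinate swap); `range_slotDelta` states the characterisation.  So the three tables `(δ_S, δ₂, δ₃)` of `MuTable` are subject to NO
constraint beyond the partition identities of (b) and the magnitude `3`: every table `InfinitePlace L → {0, ±3}`
whose sign at `w` is free is realised, and both splittings `δ₂ = δ_S, δ₃ = 0` and `δ₂ = 0, δ₃ = δ_S` occur for it.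
-/

set_option autoImplicit false

namespace Summit.Ventures.HodgeRepro

open NumberField MuTable MuTable.SeesawDatum

namespace MuTableSigns

variable {L : Type} [Field L] [NumberField L] [NumberField.IsCMField L]

/-- Sign pattern of line `0` for the target `(f, g)`: where the lines differ (`f w`) line `0` is positive iff line `1`
is not (`¬ g w`); elsewhere both lines are positive. -/
def ε₀ (f g : InfinitePlace L → Bool) (w : InfinitePlace L) : Bool := if f w = true then !(g w) else true

/-- Sign pattern of line `1` for the target `(f, g)`: where the lines differ line `1` is positive iff `g w`; elsewhere
positive. -/
def ε₁ (f g : InfinitePlace L → Bool) (w : InfinitePlace L) : Bool := if f w = true then g w else true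

/-- The target slot table for `(f, g)`. -/
noncomputable def target (δ : L) (f g : InfinitePlace L → Bool) (w : InfinitePlace L) : ℤ :=
  if f w = true then (if g w = true then 1 else -1) * (if 0 < (w.embedding δ).im then 3 else -3) else 0

/-- The slot table of any datum whose lines `0, 1` have the sign patterns `ε₀ f g`, `ε₁ f g` is the target table. -/
theorem slotDelta_eq_target (δ : L) (f g : InfinitePlace L → Bool) (S : SeesawDatum L) (w : InfinitePlace L)
    (h0 : 0 < S.r w 0 ↔ ε₀ f g w = true) (h1 : 0 < S.r w 1 ↔ ε₁ f g w = true) :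
    slotDelta δ S w = target δ f g w := by
  rw [slotDelta_eq, target]
  simp only [h0, h1, ε₀, ε₁]
  cases hf : f w <;> cases hg : g w <;> simp

/-- **Every slot table occurs, relabelling bit off.**  For every `f g` there is a seesaw datum (diagonal, `g = 1`) with
`δ_S = target δ f g` and `conjSwapAt` false at every place; hence `δ₂ = 0` and `δ₃ = δ_S` everywhere. -/
theorem exists_seesawDatum_diag (δ : L) (f g : InfinitePlace L → Bool) :
    ∃ S : SeesawDatum L, (∀ w, ¬ conjSwapAt S w) ∧ ∀ w : InfinitePlace L, slotDelta δ S w = target δ f g w := by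
  obtain ⟨a, ha, ha0, hsa⟩ := exists_conj_fixed_with_signs (L := L) (ε₀ f g)
  obtain ⟨b, hb, hb0, hsb⟩ := exists_conj_fixed_with_signs (L := L) (ε₁ f g)
  refine ⟨diag a b ha hb ha0 hb0, fun w => ?_, fun w => ?_⟩
  · rw [conjSwapAt_iff]
    have h : (diag a b ha hb ha0 hb0).r w 2 = (diag a b ha hb ha0 hb0).r w 0 := rfl
    rw [h]
    exact fun h' => h' Iff.rfl
  · exact slotDelta_eq_target δ f g _ w (hsa w) (hsb w)

/-- **Every slot table occurs, relabelling bit on where the lines differ.**  For every `f g` there is a seesaw datum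
(crossed, `g` = the coordinate swap) with `δ_S = target δ f g` and `conjSwapAt S w ↔ f w`; hence `δ₂ = δ_S` and
`δ₃ = 0` at the places where `δ_S ≠ 0`. -/
theorem exists_seesawDatum_cross (δ : L) (f g : InfinitePlace L → Bool) :
    ∃ S : SeesawDatum L, (∀ w, conjSwapAt S w ↔ f w = true) ∧
      ∀ w : InfinitePlace L, slotDelta δ S w = target δ f g w := by
  obtain ⟨a, ha, ha0, hsa⟩ := exists_conj_fixed_with_signs (L := L) (ε₀ f g)
  obtain ⟨b, hb, hb0, hsb⟩ := exists_conj_fixed_with_signs (L := L) (ε₁ f g)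
  refine ⟨cross a b ha hb ha0 hb0, fun w => ?_, fun w => ?_⟩
  · rw [conjSwapAt_iff]
    have h0 : (cross a b ha hb ha0 hb0).r w 0 = (w.embedding a).re := rfl
    have h2 : (cross a b ha hb ha0 hb0).r w 2 = (w.embedding b).re := rfl
    rw [h0, h2, hsa w, hsb w]
    simp only [ε₀, ε₁]
    cases hf : f w <;> cases hg : g w <;> simp
  · exact slotDelta_eq_target δ f g _ w (hsa w) (hsb w)

/-- **The slot tables of seesaw data are exactly the `{0, 3, -3}`-valued functions on the places.**  (`⊆`: `slotDelta`
vanishes where the lines have the same sign and is `±3` elsewhere — `MuTableSwap`; `⊇`: `exists_seesawDatum_diag`.) -/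
theorem range_slotDelta (δ : L) :
    Set.range (slotDelta δ : SeesawDatum L → InfinitePlace L → ℤ) =
      {t | ∀ w, t w = 0 ∨ t w = 3 ∨ t w = -3} := by
  classical
  ext t
  constructor
  · rintro ⟨S, rfl⟩ w
    by_cases h : (0 < S.r w 0 ↔ 0 < S.r w 1)
    · exact Or.inl ((slotDelta_eq_zero_iff δ S w).2 h)
    · exact Or.inr (slotDelta_of_not_same_sign δ S w h)
  · intro ht
    obtain ⟨S, -, hS⟩ := exists_seesawDatum_diag δ (fun w => decide (t w ≠ 0))
      (fun w => decide (t w = if 0 < (w.embedding δ).im then 3 else -3))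
    refine ⟨S, funext fun w => ?_⟩
    rw [hS w, target]
    rcases ht w with h0 | h3 | h3'
    · simp [h0]
    · by_cases hi : 0 < (w.embedding δ).im
      · simp [h3, hi]
      · simp [h3, hi]
    · by_cases hi : 0 < (w.embedding δ).im
      · simp [h3', hi]
      · simp [h3', hi]

end MuTableSigns

end Summit.Ventures.HodgeRepro
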